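import Summits.QuantumFields.BalabanUV.T4Continuum.Support.NE3TangentNoGoFlat
import Summits.QuantumFields.BalabanUV.T4Continuum.Support.BlockAverageCurrentAbelian
import HarnessLib

/-!
# T⁴ programme, node NE3 — THE k-FOLD LINEARISED BLOCK AVERAGE AT THE FLAT BACKGROUND: the frames are COARSE-EXACT,
# `(Tcoarse L)^[k] Y = (Qcoarse L)^[k] Y − dPot (framePot L k Y)`; the k-fold tangent space is «straight average coarse-exact»

NE3 formalisation swarm `b2b-balaban-t4-ne3-formalise-*`, LEAF PROVER 04 (gen 4), row **E-MLw-w3** of `t4/formal/NE3/LEAVES.md`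
(typer v1.44; owner skeleton `t4/skeletons/NE3-t4-ne3-p1.md` v1.9 §4b, sub-leaf (w3) «block-Poincaré on ker d(avgIter k)(1)» of the
socket `NE3EnergyWeightedShapes.WeightedTangentCoercive`), file (A) of the SHAPE note `t4/formal/NE3/Statements/E-MLw-w3-SHAPE-v1.md`.

CONTEXT.  After the located error G-ne3p1-g19-1 (kernel no-go `NE3TangentNoGo*`: unit-scale tangent coercivity is false at
`W = 1`), the surviving variant (R3) needs weighted coercivity on the k-fold tangent space `T = ker d(avgIter k)(1)`, whose flat
core is a POINCARÉ inequality `dirSq ≤ C·L^{2k}·gradSq` on `T`.  At the flat background the tree identifies `T` with the kernel of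
the `k`-th iterate of the contour average `SmoothRefineNeutral.Tcoarse L` (`NE3TangentNoGoFlat.cpush_flat`, `cavg_flat`,
`tangentIter_flat_of_iterate`).  THIS FILE determines the STRUCTURE of that iterate exactly, from two one-level tree facts:
[Balaban1985Averaging] §E's frame cancellation `B7Prop3Flat.frame_cancellation` (`−F̂(c₋) + T_c + F̂(c₊) = L·(Q₀A)_c`, (120)∕(124)–(125)
p. 35–36 at `V₀ = 1`) and the exactness of contour sums of exact cochains `NE3TangentNoGoWords.Tside_dPot`.

CONTENT (all [folklore]; 0 sorry; three DATA defs `Qcoarse`, `Fcoarse`, `framePot` — coarse-lattice readings of the tree's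
`B7Prop3Flat.linQ` ∕ `Fhat` and the explicit frame potential; no `def … : Prop`):
§1 one level: `Qcoarse L Y z κ := linQ L Y (L•z) κ` (Bałaban's straight `L·Q₀`, read on the coarse unit lattice), `Fcoarse L Y z :=
   Fhat L Y (L•z)`; **`Tcoarse_eq_Qcoarse_sub_dPot`**: `Tcoarse L Y z κ = Qcoarse L Y z κ − dPot (Fcoarse L Y) z κ`;
   **`Tcoarse_dPot`**: `Tcoarse L (dPot Φ) = dPot (Φ ∘ (L•))` (`L ≥ 1`); `Tcoarse_sub`, `Qcoarse_sub`, `dPot_add`∕`dPot_sub`.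
§2 k levels: `framePot L 0 Y = 0`, `framePot L (j+1) Y z = Fcoarse L ((Qcoarse L)^[j] Y) z + framePot L j Y (L•z)`;
   **`iterate_Tcoarse_eq`**: `(Tcoarse L)^[k] Y z κ = (Qcoarse L)^[k] Y z κ − dPot (framePot L k Y) z κ` — THE FRAMES ARE COARSE-EXACT.
§3 the flat tangent space (matrices): `iterate_Tcoarse_eq_zero_of_tangentIter` (converse of the tree's `tangentIter_flat_of_iterate`),
   `tangentIter_flat_iff_iterate`, and **`iterate_Qcoarse_eq_dPot_of_tangentIter`**: `TangentIter L j 1 Y →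
   (Qcoarse L)^[j+1] Y = dPot (framePot L (j+1) Y)` — a k-fold tangent direction has a COARSE-EXACT straight k-block line average
   (and nothing more: the frame potential is unconstrained).
§4 periodicity: `Qcoarse`∕`Fcoarse` of an `(L·P)`-periodic cochain are `P`-periodic; `iterate_Qcoarse_periodic`,
   **`framePot_periodic`**: `framePot L k Y` is `P`-periodic for `(L^k·P)`-periodic `Y`.
§5 entries: `asum`∕`Tside`∕`Tcoarse` and its iterates commute with taking a matrix entry (`iterate_Tcoarse_entry`) — the
   ℂ-valued reading used by the Hilbert-space step of file (C).

WHY IT MATTERS (E-MLw-w3, honest).  `framePot` is ROUGH (the composite tree contours funnel through the block corner: single bond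
values carry O(1) weight), so tangency controls only the COARSE DIVERGENCE class of the straight average; the Poincaré constant on
`ker (Tcoarse L)^[k]` that files (B)∕(C) prove is `C(d)·n·N²·L^{2k}` (k-free, N = torus size in `L^k`-blocks), and N-free only on
`ker (Qcoarse L)^[k]` (the double-bar ∕ frames-removed tangent space, `BlockAveragePushDirSplit.dbarLin_flat`).

HONEST FRAMING.  Lattice kinematics of the LINEARISED average at the FLAT configuration (our frame); exact identities, no estimate;
nothing about Bałaban's minimisers, (ML_w), T-E_w or NE3 is asserted; NE3 NOT proved; spine 0∕9; finite T⁴ rung (B)+1 — NOT infinite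
volume, NOT mass gap, NOT BetaPertH, NOT Clay.  ABSOLUTE RULE kept: no printed sentence is a hypothesis (context:
[Balaban1985Averaging] (47)–(48) p. 25, (112) p. 34, (120)–(125) pp. 35–36).  PLACEMENT: `Summits/QuantumFields/BalabanUV/`;
imports the accepted `NE3TangentNoGoFlat` (Tcoarse ∕ TangentIter at flat) and `BlockAverageCurrentAbelian` (`asum_shift`) BY NAME.
-/

set_option autoImplicit false

open scoped BigOperators Matrix.Norms.L2Operator
open Finset

namespace Summit.QuantumFields.BalabanUV.T4Continuum.NE3TangentFlatStructure

open Literature.MathematicalPhysics.QuantumFieldTheory.Balaban1983to89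
open B7Prop1Explicit B7Prop3Flat
open AveragingDeficitMultiLevelPrep (TangentIter cpush)
open AveragingDeficitChartCalculus (cavg)
open BlockAveragePushDirSplit (flat)
open SmoothRefineNeutral (Tcoarse Tside_sub asum_sub Tcoarse_add_period Tside_add_period)
open NE3TangentNoGoWords (dPot asum_dPot Tside_dPot)
open NE3TangentNoGoFlat (cpush_flat cavg_flat tangentIter_flat_of_iterate)
open BlockAverageCurrentAbelian (asum_shift Tside_shift)

noncomputable section

variable {d : ℕ}

/-! ## §1 One level: the contour average is the straight average minus the coboundary of the frame -/

section OneLevel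

variable {𝔸 : Type*} [NormedRing 𝔸] [NormedAlgebra ℂ 𝔸]

/-- THE STRAIGHT AVERAGE READ ON THE COARSE UNIT LATTICE: `Qcoarse L Y (z, κ) := L·(Q₀Y)_c` for the `L`-bond
`c = ⟨L•z, L•z + Le_κ⟩` (`B7Prop3Flat.linQ` at the corner `L•z`). [cite: Balaban1985Averaging, (122) p.36] -/
def Qcoarse (L : ℕ) (Y : Site d → Fin d → 𝔸) : Site d → Fin d → 𝔸 := fun z κ => linQ L Y ((L : ℤ) • z) κ

/-- THE LINEARISED FRAME READ ON THE COARSE UNIT LATTICE: `Fcoarse L Y z := F̂(L•z) = Σ_{x∈B(L•z)} L^{−d} Y(Γ_{L•z,x})`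
(`B7Prop3Flat.Fhat` at the corner `L•z`). [cite: Balaban1985Averaging, (112) p.34] -/
def Fcoarse (L : ℕ) (Y : Site d → Fin d → 𝔸) : Site d → 𝔸 := fun z => Fhat L Y ((L : ℤ) • z)

omit [NormedAlgebra ℂ 𝔸] in
/-- The coboundary is additive. [folklore] -/
theorem dPot_add (Φ Ψ : Site d → 𝔸) (z : Site d) (κ : Fin d) :
    dPot (fun w => Φ w + Ψ w) z κ = dPot Φ z κ + dPot Ψ z κ := by
  simp only [dPot]; abel

omit [NormedAlgebra ℂ 𝔸] in
/-- The coboundary of the zero potential vanishes. [folklore] -/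
theorem dPot_zero (z : Site d) (κ : Fin d) : dPot (fun _ : Site d => (0 : 𝔸)) z κ = 0 := by
  simp only [dPot, sub_self]

omit [NormedAlgebra ℂ 𝔸] in
/-- Rescaling the potential's argument commutes with the coboundary up to the scale: `dPot (Φ ∘ L•) z κ =
Φ(L•z + L•e_κ) − Φ(L•z)`. [folklore] -/
theorem dPot_comp_smul (L : ℕ) (Φ : Site d → 𝔸) (z : Site d) (κ : Fin d) :
    dPot (fun w => Φ ((L : ℤ) • w)) z κ = Φ ((L : ℤ) • z + (L : ℤ) • e κ) - Φ ((L : ℤ) • z) := by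
  simp only [dPot, smul_add]

/-- **ONE LEVEL — THE CONTOUR AVERAGE IS THE STRAIGHT AVERAGE MINUS THE COBOUNDARY OF THE FRAME**:
`Tcoarse L Y z κ = Qcoarse L Y z κ − dPot (Fcoarse L Y) z κ` (the tree's `frame_cancellation`, read on the coarse lattice).
[cite: Balaban1985Averaging, (120) p.35, (124)–(125) p.36] -/
theorem Tcoarse_eq_Qcoarse_sub_dPot (L : ℕ) (Y : Site d → Fin d → 𝔸) (z : Site d) (κ : Fin d) :
    Tcoarse L Y z κ = Qcoarse L Y z κ - dPot (Fcoarse L Y) z κ := by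
  have h := frame_cancellation L Y ((L : ℤ) • z) κ
  simp only [Tcoarse, Qcoarse, Fcoarse, dPot, smul_add]
  rw [← h]
  abel

/-- **ONE LEVEL — THE CONTOUR AVERAGE OF AN EXACT COCHAIN IS EXACT**, with the potential read on the coarse lattice:
`Tcoarse L (dPot Φ) z κ = dPot (Φ ∘ L•) z κ` (`L ≥ 1`; the weights of (42) sum to one). [folklore] -/
theorem Tcoarse_dPot {L : ℕ} (hL : 1 ≤ L) (Φ : Site d → 𝔸) (z : Site d) (κ : Fin d) :
    Tcoarse L (dPot Φ) z κ = dPot (fun w => Φ ((L : ℤ) • w)) z κ := by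
  unfold Tcoarse
  rw [Tside_dPot L hL, dPot_comp_smul]

/-- `Tcoarse` is additive: subtraction. [folklore] -/
theorem Tcoarse_sub (L : ℕ) (A B : Site d → Fin d → 𝔸) (z : Site d) (κ : Fin d) :
    Tcoarse L (fun y μ => A y μ - B y μ) z κ = Tcoarse L A z κ - Tcoarse L B z κ := by
  unfold Tcoarse; rw [Tside_sub]

/-- `linQ` is additive: subtraction. [folklore] -/
theorem linQ_sub (L : ℕ) (A B : Site d → Fin d → 𝔸) (q : Site d) (κ : Fin d) :
    linQ L (fun y μ => A y μ - B y μ) q κ = linQ L A q κ - linQ L B q κ := by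
  simp only [linQ, asum_sub, smul_sub, Finset.sum_sub_distrib]

/-- `Qcoarse` is additive: subtraction. [folklore] -/
theorem Qcoarse_sub (L : ℕ) (A B : Site d → Fin d → 𝔸) (z : Site d) (κ : Fin d) :
    Qcoarse L (fun y μ => A y μ - B y μ) z κ = Qcoarse L A z κ - Qcoarse L B z κ := by
  unfold Qcoarse; rw [linQ_sub]

/-- The straight average of an exact cochain is exact: `Qcoarse L (dPot Φ) z κ = dPot (block mean of Φ ∘ L•) z κ`, explicitly
`Σ_r L^{−d} (Φ(L•z + r + Le_κ) − Φ(L•z + r))`. [folklore] -/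
theorem Qcoarse_dPot (L : ℕ) (Φ : Site d → 𝔸) (z : Site d) (κ : Fin d) :
    Qcoarse L (dPot Φ) z κ
      = dPot (fun w : Site d => (∑ r : Fin d → Fin L, (((L : ℝ) ^ d)⁻¹ : ℝ) • Φ ((L : ℤ) • w + boxVec L r) : 𝔸)) z κ := by
  simp only [Qcoarse, linQ, dPot, asum_dPot, disp_seg, smul_sub, Finset.sum_sub_distrib, smul_add]
  congr 1
  refine Finset.sum_congr rfl fun r _ => ?_
  congr 1
  abel_nf

end OneLevel

/-! ## §2 k levels: the frames are coarse-exact -/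

section Levels

variable {𝔸 : Type*} [NormedRing 𝔸] [NormedAlgebra ℂ 𝔸]

/-- THE FRAME POTENTIAL OF THE k-FOLD AVERAGE (explicit recursion): `framePot L 0 Y = 0`,
`framePot L (j+1) Y z = F̂((Qcoarse L)^[j] Y)(L•z) + framePot L j Y (L•z)`. [folklore] -/
def framePot (L : ℕ) : ℕ → (Site d → Fin d → 𝔸) → Site d → 𝔸
  | 0, _ => fun _ => 0
  | j + 1, Y => fun z => Fcoarse L ((Qcoarse L)^[j] Y) z + framePot L j Y ((L : ℤ) • z)

/-- `framePot L 0 Y = 0`. [folklore] -/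
@[simp] theorem framePot_zero (L : ℕ) (Y : Site d → Fin d → 𝔸) (z : Site d) : framePot L 0 Y z = 0 := rfl

/-- The recursion of `framePot`. [folklore] -/
theorem framePot_succ (L : ℕ) (j : ℕ) (Y : Site d → Fin d → 𝔸) (z : Site d) :
    framePot L (j + 1) Y z = Fcoarse L ((Qcoarse L)^[j] Y) z + framePot L j Y ((L : ℤ) • z) := rfl

/-- **THE FRAMES ARE COARSE-EXACT**: for every `k`,
`(Tcoarse L)^[k] Y z κ = (Qcoarse L)^[k] Y z κ − dPot (framePot L k Y) z κ` (`L ≥ 1`).  By induction: one level is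
`Tcoarse_eq_Qcoarse_sub_dPot`, and the contour average of the inherited coboundary is the coboundary of the rescaled potential
(`Tcoarse_dPot`). [folklore] -/
theorem iterate_Tcoarse_eq {L : ℕ} (hL : 1 ≤ L) :
    ∀ (k : ℕ) (Y : Site d → Fin d → 𝔸) (z : Site d) (κ : Fin d),
      (Tcoarse L)^[k] Y z κ = (Qcoarse L)^[k] Y z κ - dPot (framePot L k Y) z κ
  | 0, Y, z, κ => by simp [dPot]
  | k + 1, Y, z, κ => by
      have ih : (Tcoarse L)^[k] Y = fun w μ => (Qcoarse L)^[k] Y w μ - dPot (framePot L k Y) w μ :=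
        funext fun w => funext fun μ => iterate_Tcoarse_eq hL k Y w μ
      rw [Function.iterate_succ_apply', Function.iterate_succ_apply', ih, Tcoarse_sub, Tcoarse_eq_Qcoarse_sub_dPot,
        Tcoarse_dPot hL]
      have hG : dPot (framePot L (k + 1) Y) z κ
          = dPot (Fcoarse L ((Qcoarse L)^[k] Y)) z κ + dPot (fun w => framePot L k Y ((L : ℤ) • w)) z κ := by
        rw [← dPot_add]; rfl
      rw [hG]
      abel

/-- The same as an identity of cochains. [folklore] -/
theorem iterate_Tcoarse_eq' {L : ℕ} (hL : 1 ≤ L) (k : ℕ) (Y : Site d → Fin d → 𝔸) :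
    (Tcoarse L)^[k] Y = fun z κ => (Qcoarse L)^[k] Y z κ - dPot (framePot L k Y) z κ :=
  funext fun z => funext fun κ => iterate_Tcoarse_eq hL k Y z κ

/-- **THE KERNEL OF THE k-FOLD CONTOUR AVERAGE**: `(Tcoarse L)^[k] Y = 0` iff the straight k-fold average is the coboundary of
the frame potential, `(Qcoarse L)^[k] Y = dPot (framePot L k Y)`. [folklore] -/
theorem iterate_Tcoarse_eq_zero_iff {L : ℕ} (hL : 1 ≤ L) (k : ℕ) (Y : Site d → Fin d → 𝔸) :
    (Tcoarse L)^[k] Y = 0 ↔ (Qcoarse L)^[k] Y = dPot (framePot L k Y) := by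
  rw [iterate_Tcoarse_eq' hL]
  constructor
  · intro h
    funext z κ
    have := congr_fun (congr_fun h z) κ
    exact sub_eq_zero.mp this
  · intro h
    funext z κ
    rw [h]
    exact sub_self _

end Levels

/-! ## §3 The k-fold tangent space at the flat background (matrices) -/

section Tangent

variable {n : Type*} [Fintype n] [DecidableEq n]

/-- **TANGENT ⟹ THE ITERATED CONTOUR AVERAGE VANISHES**: `TangentIter L j 1 Y → (Tcoarse L)^[j+1] Y = 0` (converse of the tree's
`NE3TangentNoGoFlat.tangentIter_flat_of_iterate`; same induction on the tower). [folklore] -/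
theorem iterate_Tcoarse_eq_zero_of_tangentIter {L : ℕ} (hL : 1 ≤ L) :
    ∀ (j : ℕ) (Y : Site d → Fin d → Matrix n n ℂ), TangentIter L j (flat (d := d) (n := n)) Y → (Tcoarse L)^[j + 1] Y = 0
  | 0, Y, h => by
      change cpush L flat Y = 0 at h
      rw [cpush_flat L hL] at h
      simpa using h
  | j + 1, Y, h => by
      change TangentIter L j (cavg L flat) (cpush L flat Y) at h
      rw [cavg_flat, cpush_flat L hL] at h
      rw [Function.iterate_succ_apply]
      exact iterate_Tcoarse_eq_zero_of_tangentIter hL j _ h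

/-- **THE k-FOLD FLAT TANGENT SPACE IS `ker (Tcoarse L)^[k]`** (both directions). [folklore] -/
theorem tangentIter_flat_iff_iterate {L : ℕ} (hL : 1 ≤ L) (j : ℕ) (Y : Site d → Fin d → Matrix n n ℂ) :
    TangentIter L j (flat (d := d) (n := n)) Y ↔ (Tcoarse L)^[j + 1] Y = 0 :=
  ⟨iterate_Tcoarse_eq_zero_of_tangentIter hL j Y, tangentIter_flat_of_iterate L hL j Y⟩

/-- **A k-FOLD TANGENT DIRECTION HAS A COARSE-EXACT STRAIGHT k-BLOCK AVERAGE**: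
`TangentIter L j 1 Y → (Qcoarse L)^[j+1] Y = dPot (framePot L (j+1) Y)`. [folklore] -/
theorem iterate_Qcoarse_eq_dPot_of_tangentIter {L : ℕ} (hL : 1 ≤ L) {j : ℕ} {Y : Site d → Fin d → Matrix n n ℂ}
    (h : TangentIter L j (flat (d := d) (n := n)) Y) : (Qcoarse L)^[j + 1] Y = dPot (framePot L (j + 1) Y) :=
  (iterate_Tcoarse_eq_zero_iff hL (j + 1) Y).mp (iterate_Tcoarse_eq_zero_of_tangentIter hL j Y h)

/-- … and conversely a direction whose straight k-block average VANISHES is tangent iff its frame potential is coarse-closed —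
in particular every `Y` with `(Qcoarse L)^[j+1] Y = 0` AND `dPot (framePot L (j+1) Y) = 0` is tangent. [folklore] -/
theorem tangentIter_flat_of_Qcoarse_of_framePot {L : ℕ} (hL : 1 ≤ L) {j : ℕ} {Y : Site d → Fin d → Matrix n n ℂ}
    (hQ : (Qcoarse L)^[j + 1] Y = 0) (hF : dPot (framePot L (j + 1) Y) = 0) :
    TangentIter L j (flat (d := d) (n := n)) Y :=
  tangentIter_flat_of_iterate L hL j Y ((iterate_Tcoarse_eq_zero_iff hL (j + 1) Y).mpr (by rw [hQ, hF]))

end Tangent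

/-! ## §4 Periodicity -/

section Periodic

variable {𝔸 : Type*} [NormedRing 𝔸] [NormedAlgebra ℂ 𝔸]

/-- Translation covariance of the straight average: `linQ L (Y(· + v)) q κ = linQ L Y (q + v) κ`. [folklore] -/
theorem linQ_shift (L : ℕ) (Y : Site d → Fin d → 𝔸) (v q : Site d) (κ : Fin d) :
    linQ L (fun y μ => Y (y + v) μ) q κ = linQ L Y (q + v) κ := by
  unfold linQ
  refine Finset.sum_congr rfl fun r _ => ?_
  rw [asum_shift, add_right_comm]

/-- Translation covariance of the linearised frame: `Fhat L (Y(· + v)) q = Fhat L Y (q + v)`. [folklore] -/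
theorem Fhat_shift (L : ℕ) (Y : Site d → Fin d → 𝔸) (v q : Site d) :
    Fhat L (fun y μ => Y (y + v) μ) q = Fhat L Y (q + v) := by
  unfold Fhat
  refine Finset.sum_congr rfl fun r _ => ?_
  rw [asum_shift]

/-- PERIODICITY of the straight average: an `(L·P)`-periodic cochain has a `P`-periodic coarse straight average. [folklore] -/
theorem Qcoarse_add_period (L : ℕ) (Y : Site d → Fin d → 𝔸) {P : ℤ}
    (hY : ∀ (y : Site d) (τ μ : Fin d), Y (y + ((L : ℤ) * P) • e τ) μ = Y y μ) (z : Site d) (τ κ : Fin d) :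
    Qcoarse L Y (z + P • e τ) κ = Qcoarse L Y z κ := by
  have hper : (fun y μ => Y (y + ((L : ℤ) * P) • e τ) μ) = Y := funext fun y => funext fun μ => hY y τ μ
  unfold Qcoarse
  rw [smul_add, smul_smul, ← linQ_shift, hper]

/-- PERIODICITY of the linearised frame read on the coarse lattice. [folklore] -/
theorem Fcoarse_add_period (L : ℕ) (Y : Site d → Fin d → 𝔸) {P : ℤ}
    (hY : ∀ (y : Site d) (τ μ : Fin d), Y (y + ((L : ℤ) * P) • e τ) μ = Y y μ) (z : Site d) (τ : Fin d) :
    Fcoarse L Y (z + P • e τ) = Fcoarse L Y z := by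
  have hper : (fun y μ => Y (y + ((L : ℤ) * P) • e τ) μ) = Y := funext fun y => funext fun μ => hY y τ μ
  unfold Fcoarse
  rw [smul_add, smul_smul, ← Fhat_shift, hper]

/-- PERIODICITY of the iterated straight average: an `(L^k·P)`-periodic cochain has a `P`-periodic `(Qcoarse L)^[k]`. [folklore] -/
theorem iterate_Qcoarse_add_period (L : ℕ) :
    ∀ (k : ℕ) (Y : Site d → Fin d → 𝔸) {P : ℤ},
      (∀ (y : Site d) (τ μ : Fin d), Y (y + ((L : ℤ) ^ k * P) • e τ) μ = Y y μ) →
        ∀ (z : Site d) (τ κ : Fin d), (Qcoarse L)^[k] Y (z + P • e τ) κ = (Qcoarse L)^[k] Y z κ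
  | 0, Y, P, hY, z, τ, κ => by simpa using hY z τ κ
  | k + 1, Y, P, hY, z, τ, κ => by
      rw [Function.iterate_succ_apply]
      refine iterate_Qcoarse_add_period L k (Qcoarse L Y) (fun y τ' μ => ?_) z τ κ
      refine Qcoarse_add_period L Y (fun w τ'' μ' => ?_) y τ' μ
      have := hY w τ'' μ'
      rwa [pow_succ, mul_comm ((L : ℤ) ^ k) (L : ℤ), mul_assoc] at this

/-- **PERIODICITY OF THE FRAME POTENTIAL**: an `(L^k·P)`-periodic cochain has a `P`-periodic `framePot L k`. [folklore] -/
theorem framePot_add_period (L : ℕ) :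
    ∀ (k : ℕ) (Y : Site d → Fin d → 𝔸) {P : ℤ},
      (∀ (y : Site d) (τ μ : Fin d), Y (y + ((L : ℤ) ^ k * P) • e τ) μ = Y y μ) →
        ∀ (z : Site d) (τ : Fin d), framePot L k Y (z + P • e τ) = framePot L k Y z
  | 0, Y, P, _, z, τ => rfl
  | k + 1, Y, P, hY, z, τ => by
      rw [framePot_succ, framePot_succ]
      -- `Y` has period `L^k·(L·P)`
      have hY' : ∀ (y : Site d) (τ μ : Fin d), Y (y + ((L : ℤ) ^ k * ((L : ℤ) * P)) • e τ) μ = Y y μ := by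
        intro y τ' μ
        have := hY y τ' μ
        rwa [pow_succ, mul_assoc] at this
      have hQ : ∀ (y : Site d) (τ μ : Fin d),
          (Qcoarse L)^[k] Y (y + ((L : ℤ) * P) • e τ) μ = (Qcoarse L)^[k] Y y μ :=
        iterate_Qcoarse_add_period L k Y hY'
      have hF := Fcoarse_add_period L ((Qcoarse L)^[k] Y) hQ z τ
      have hG := framePot_add_period L k Y hY' ((L : ℤ) • z) τ
      rw [hF, smul_add, smul_smul, hG]

omit [NormedAlgebra ℂ 𝔸] in
/-- PERIODICITY of the coboundary of a periodic potential. [folklore] -/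
theorem dPot_add_period {Φ : Site d → 𝔸} {P : ℤ} (hΦ : ∀ (z : Site d) (τ : Fin d), Φ (z + P • e τ) = Φ z)
    (z : Site d) (τ κ : Fin d) : dPot Φ (z + P • e τ) κ = dPot Φ z κ := by
  unfold dPot
  rw [add_right_comm, hΦ, hΦ]

end Periodic

/-! ## §5 Entries: the contour average commutes with taking a matrix entry -/

section Entry

variable {n : Type*} [Fintype n] [DecidableEq n]

/-- `stepA` commutes with taking an entry. [folklore] -/
theorem stepA_entry (Y : Site d → Fin d → Matrix n n ℂ) (x : Site d) (l : Letter d) (i j : n) :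
    stepA Y x l i j = stepA (fun y μ => Y y μ i j) x l := by
  obtain ⟨μ, b⟩ := l
  cases b
  · simp [stepA]
  · simp [stepA]

/-- The contour sum commutes with taking an entry. [folklore] -/
theorem asum_entry (Y : Site d → Fin d → Matrix n n ℂ) (i j : n) :
    ∀ (x : Site d) (w : List (Letter d)), asum Y x w i j = asum (fun y μ => Y y μ i j) x w
  | x, [] => by simp
  | x, l :: w => by
      rw [asum_cons, asum_cons, Matrix.add_apply, stepA_entry, asum_entry Y i j (x + l.vec) w]

/-- The contour average commutes with taking an entry. [folklore] -/
theorem Tside_entry (L : ℕ) (Y : Site d → Fin d → Matrix n n ℂ) (q : Site d) (κ : Fin d) (i j : n) :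
    Tside L Y q κ i j = Tside L (fun y μ => Y y μ i j) q κ := by
  unfold Tside
  rw [Matrix.sum_apply]
  refine Finset.sum_congr rfl fun r _ => ?_
  rw [Matrix.smul_apply, asum_entry]

/-- `Tcoarse` commutes with taking an entry. [folklore] -/
theorem Tcoarse_entry (L : ℕ) (Y : Site d → Fin d → Matrix n n ℂ) (z : Site d) (κ : Fin d) (i j : n) :
    Tcoarse L Y z κ i j = Tcoarse L (fun y μ => Y y μ i j) z κ := by
  unfold Tcoarse; exact Tside_entry L Y _ κ i j

/-- **The iterated contour average commutes with taking an entry.** [folklore] -/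
theorem iterate_Tcoarse_entry (L : ℕ) (i j : n) :
    ∀ (k : ℕ) (Y : Site d → Fin d → Matrix n n ℂ) (z : Site d) (κ : Fin d),
      (Tcoarse L)^[k] Y z κ i j = (Tcoarse L)^[k] (fun y μ => Y y μ i j) z κ
  | 0, Y, z, κ => rfl
  | k + 1, Y, z, κ => by
      rw [Function.iterate_succ_apply, Function.iterate_succ_apply, iterate_Tcoarse_entry L i j k (Tcoarse L Y) z κ]
      have h : (fun y μ => Tcoarse L Y y μ i j) = Tcoarse L (fun y μ => Y y μ i j) :=
        funext fun y => funext fun μ => Tcoarse_entry L Y y μ i j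
      rw [h]

/-- Hence every entry of a cochain in `ker (Tcoarse L)^[k]` is in the (ℂ-valued) kernel. [folklore] -/
theorem iterate_Tcoarse_entry_eq_zero (L : ℕ) {k : ℕ} {Y : Site d → Fin d → Matrix n n ℂ}
    (h : (Tcoarse L)^[k] Y = 0) (i j : n) : (Tcoarse L)^[k] (fun y μ => Y y μ i j) = 0 := by
  funext z κ
  rw [← iterate_Tcoarse_entry, h]
  rfl

end Entry

end

end Summit.QuantumFields.BalabanUV.T4Continuum.NE3TangentFlatStructure
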